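/-
Copyright (c) 2026 the pub-hodgecm-mathlib formalisation cell (harness21).  Prover seat hodgecm-mathlib-K2E4-p11 (g8): Track B «K2-LIT»,
#184♮ = hLiu418 = stmt-HodgeConjecture-24832; socket #41 KIND W block — (KW-car) the CARRIER ∕ CHARACTER letters of K2E4-p10 (g9)'s KW payer head `kindW_block_of_record`
(LEAD F0P6-plan (g14) BATCH #126 (2)).  THEOREMS ONLY (no `def`, no `instance`, no `notation`, no named-fact hypothesis, no `sorry`).
-/
import Summits.HodgeConjecture.HodgeConjecture.Theorems.K2LiuSiegelUnipotentHaarPinned     -- ★ Φ3b (K2Liu-p03) `exists_isHaarMeasure_map_unipDeltaSplit_eq_prod_pi_rpMeasure`, §1 topology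
import Literature.NumberTheory.GaloisRepresentations.HeckeCharacterCofiniteProofs           -- ★ `HeckeCharacter.isUnramifiedAt_cofinite_holds`
import Literature.NumberTheory.Automorphic.UnitaryGroupAutomorphicRep                       -- ★ `UnitaryGroup.PlacesOver`
import HarnessLib

/-!
# Crux `HLiu418`, socket #41, KIND W — `K2LiuKindWCarrierOfRecord`: THE CARRIER AND CHARACTER LETTERS `T₀ νv hνK νinf hσ hmap hχ` OF THE KIND-W PAYER HEAD

Cell `hodgecm-mathlib`, crux item hLiu418 = `stmt-HodgeConjecture-24832`; squad K2 ∕ K2Liu (L1, LEAD F0P6-plan (g14)), road `K2_Liu`, socket #41, KIND W block; consumer =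
K2E4-p10 (g9) `K2LiuSiegelEisensteinKindWOfRecord.kindW_block_of_record` (its hypothesis-first residue «(x-a) LOCAL»: `T₀ νv hνK νinf hσ hmap` + `hχ`) ∕ K2E3-typ2's tie.
Lane `--supports stmt-HodgeConjecture-24832 --as helper` (count-neutral helper; closes no socket by itself).  General frame `e : Fin N × Fin M ≃ Fin n`, general `χ`.

THE MATHEMATICS [CasselsFrohlichANT1967, Ch. XV (Tate) §3.3, Lemma 3.2.1], [BorelJacquet1979, §4.1], [Bump1997, §3.3 Prop. 3.3.2], [TateThesis1967, Lemma 3.2.1].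
(i) LOCAL CARRIERS: at every finite place `v` of `L⁺` the Haar measure of `N_Δ(L⁺_v)` normalised by `νv(K_{H,v} ∩ N_Δ(L⁺_v)) = 1` — Mathlib `Measure.haarMeasure` on the positive
compact `K_{H,v} ∩ N_Δ(L⁺_v)` (compact open: ★ `isCompact_inH_unipDeltaLoc`, ★ `isOpen_inH_unipDeltaLoc`), `haarMeasure_self`; Haar and σ-finite (★ local compactness, second
countability of `N_Δ(L⁺_v)`).  (ii) FACTORISATION AT EVERY FINITE `T`: ★ Φ3b `exists_isHaarMeasure_map_unipDeltaSplit_eq_prod_pi_rpMeasure` (K2Liu-p03) gives a σ-finite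
Haar `ν_∞(T)` on `N_Δ(L⁺ ⊗ ℝ)` with `(unipDeltaSplitAt T)_* νN = ν_∞(T) ⊗ ((⊗_{v∈T} νv) ⊗ ∏'_{v∉T}(νv; K_{H,v} ∩ N_Δ))` — chosen per `T` (`νinf T`).  (iii) RAMIFICATION: a Hecke
character is unramified at all but finitely many places (★ `HeckeCharacter.isUnramifiedAt_cofinite_holds`, Tate's Lemma 3.2.1); `T₀` := the places of `L⁺` below the
finitely many ramified places of `χ`, so `χ` is unramified at every place of `L` over `v ∉ T₀`.
* §1 `exists_localCarriers`; §2 HEAD **`exists_kindW_carrierLetters`**.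
HONEST LABEL.  Count-neutral helper; it retires nothing by itself: `HC_CM` is proved only modulo the 7 printed citations (2 remaining named inputs:
hLiu418 = `stmt-HodgeConjecture-24832`, h413 = `stmt-HodgeConjecture-24833`) until rung 0 closes.

## References
* [CasselsFrohlichANT1967] J. W. S. Cassels, A. Fröhlich (eds.), *Algebraic Number Theory* (1967), Ch. XV (Tate) §3.2–§3.3.
* [BorelJacquet1979] A. Borel, H. Jacquet, PSPM 33.1 (1979), §4.1.
* [Bump1997] D. Bump, *Automorphic Forms and Representations* (1997), §3.3 Prop. 3.3.2.
* [TateThesis1967] J. Tate, *Fourier analysis in number fields and Hecke's zeta-functions* (1950∕1967), Lemma 3.2.1, §4.3.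
-/

set_option autoImplicit false
set_option linter.dupNamespace false -- the mandated namespace repeats `HodgeConjecture.HodgeConjecture`

noncomputable section

open scoped Matrix RestrictedProduct ENNReal NNReal
open NumberField IsDedekindDomain MeasureTheory Measure Filter TopologicalSpace
open Literature.NumberTheory.Automorphic Literature.NumberTheory.GaloisRepresentations
open Literature.NumberTheory.GelbartRogawski1991 Literature.NumberTheory.GelbartRogawski1991.GRConstruction
open Literature.NumberTheory.K2Lit.SiegelDoubled
open Literature.NumberTheory.K2Lit.PlaceSplitting
open Literature.MeasureTheory.RestrictedProduct
open Literature.Topology.Algebra.RestrictedProduct (inH isOpen_inH)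
open Summit.HodgeConjecture.HodgeConjecture.Cruxes.HLiu418.K2LiuSiegelUnipotentLocalDefs
open Summit.HodgeConjecture.HodgeConjecture.Cruxes.HLiu418.K2LiuSiegelUnipotentSplitDefs
open Summit.HodgeConjecture.HodgeConjecture.Cruxes.HLiu418.K2LiuSiegelUnipotentSplitAtDefs
open Summit.HodgeConjecture.HodgeConjecture.Cruxes.HLiu418.K2LiuSiegelUnipotentHaarPinned

namespace Summit.HodgeConjecture.HodgeConjecture.Cruxes.HLiu418.K2LiuKindWCarrierOfRecord

variable (L : Type) [Field L] [NumberField L] [IsCMField L]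
variable {N M n : ℕ} (e : Fin N × Fin M ≃ Fin n)
  (dV : Fin N → L) (hdV : ∀ i, IsCMField.complexConj L (dV i) = dV i)
  (dW : Fin M → L) (hdW : ∀ i, IsCMField.complexConj L (dW i) = dW i)

/-! ## §1 The local carriers `νv`, normalised by `νv(K_{H,v} ∩ N_Δ(L⁺_v)) = 1` -/

/-- **LOCAL CARRIERS**: at every finite place `v` of `L⁺` a σ-finite Haar measure `νv` on `N_Δ(L⁺_v)` with `νv(K_{H,v} ∩ N_Δ(L⁺_v)) = 1` — Mathlib `Measure.haarMeasure` on
the compact open subgroup `K_{H,v} ∩ N_Δ(L⁺_v)` (★ `isCompact_inH_unipDeltaLoc`, ★ `isOpen_inH_unipDeltaLoc`), `haarMeasure_self`.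
[cite: CasselsFrohlichANT1967, Ch. XV (Tate) §3.3] [cite: Bump1997, §3.3 Prop. 3.3.2] -/
theorem exists_localCarriers
    [∀ v : HeightOneSpectrum (𝓞 (Fp L)), MeasurableSpace ↥(unipDeltaLoc L e dV hdV dW hdW v)]
    [∀ v : HeightOneSpectrum (𝓞 (Fp L)), BorelSpace ↥(unipDeltaLoc L e dV hdV dW hdW v)] :
    ∃ (νv : ∀ v : HeightOneSpectrum (𝓞 (Fp L)), Measure ↥(unipDeltaLoc L e dV hdV dW hdW v))
      (_ : ∀ v, (νv v).IsHaarMeasure) (_ : ∀ v, SigmaFinite (νv v)),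
      ∀ v, νv v (((inH (fun v => UnitaryGroup.localInt L (IsCMField.complexConj L) (n + n) (hermD L e dV hdV dW hdW) v)
        (fun v => unipDeltaLoc L e dV hdV dW hdW v) v) : Subgroup ↥(unipDeltaLoc L e dV hdV dW hdW v)) : Set ↥(unipDeltaLoc L e dV hdV dW hdW v)) = 1 := by
  haveI : ∀ v, SecondCountableTopology ↥(unipDeltaLoc L e dV hdV dW hdW v) := fun v => secondCountableTopology_unipDeltaLoc L e dV hdV dW hdW v
  haveI : ∀ v, LocallyCompactSpace ↥(unipDeltaLoc L e dV hdV dW hdW v) := fun v => locallyCompactSpace_unipDeltaLoc L e dV hdV dW hdW v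
  -- the compact open subgroup as a positive compact
  have hK₀ : ∀ v : HeightOneSpectrum (𝓞 (Fp L)), ∃ K₀ : PositiveCompacts ↥(unipDeltaLoc L e dV hdV dW hdW v), (K₀ : Set ↥(unipDeltaLoc L e dV hdV dW hdW v)) =
      (((inH (fun v => UnitaryGroup.localInt L (IsCMField.complexConj L) (n + n) (hermD L e dV hdV dW hdW) v)
        (fun v => unipDeltaLoc L e dV hdV dW hdW v) v) : Subgroup ↥(unipDeltaLoc L e dV hdV dW hdW v)) : Set ↥(unipDeltaLoc L e dV hdV dW hdW v)) := fun v =>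
    ⟨⟨⟨_, isCompact_inH_unipDeltaLoc L e dV hdV dW hdW v⟩, by
        show (interior (((inH (fun v => UnitaryGroup.localInt L (IsCMField.complexConj L) (n + n) (hermD L e dV hdV dW hdW) v)
          (fun v => unipDeltaLoc L e dV hdV dW hdW v) v) : Subgroup ↥(unipDeltaLoc L e dV hdV dW hdW v)) : Set ↥(unipDeltaLoc L e dV hdV dW hdW v))).Nonempty
        rw [(isOpen_inH_unipDeltaLoc L e dV hdV dW hdW v).interior_eq]
        exact ⟨1, Subgroup.one_mem _⟩⟩, rfl⟩
  choose K₀ hK₀ using hK₀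
  refine ⟨fun v => haarMeasure (K₀ v), fun v => inferInstance, fun v => inferInstance, fun v => ?_⟩
  rw [← hK₀ v]
  exact haarMeasure_self

/-! ## §2 HEAD: the carrier and character letters of the KIND-W payer head -/

/-- **HEAD — THE (x-a) «LOCAL» CARRIER ∕ CHARACTER LETTERS `T₀ νv hνK νinf hσ hmap hχ` OF `kindW_block_of_record`.**  For a Haar measure `νN` on `N_Δ(𝔸)` and a Hecke character `χ`
(at the TOP: `Measure.haar` and `toHeckeCharacter L lam⁻¹`): local carriers `νv` (Haar, σ-finite, `νv(K_{H,v} ∩ N_Δ(L⁺_v)) = 1` at EVERY `v`, §1); archimedean carriers `νinf T`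
(σ-finite) with the FACTORISATION `(unipDeltaSplitAt T)_* νN = νinf T ⊗ ((⊗_{v∈T} νv) ⊗ ∏'_{v∉T}(νv; K_{H,v} ∩ N_Δ))` at EVERY finite `T` (★ Φ3b
`exists_isHaarMeasure_map_unipDeltaSplit_eq_prod_pi_rpMeasure`, chosen per `T`); and a finite `T₀` off which `χ` is unramified at every place of `L` above
(★ `HeckeCharacter.isUnramifiedAt_cofinite_holds`). Consumer: `obtain ⟨T₀, νv, hH, hσv, hνK, νinf, hσ, hmap, hχ⟩ := …; haveI := hH; haveI := hσv`.
[cite: CasselsFrohlichANT1967, Ch. XV (Tate) §3.3] [cite: BorelJacquet1979, §4.1] [cite: TateThesis1967, Lemma 3.2.1] -/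
theorem exists_kindW_carrierLetters (χ : HeckeCharacter L)
    [MeasurableSpace ↥(unipDelta L e dV hdV dW hdW)] [BorelSpace ↥(unipDelta L e dV hdV dW hdW)]
    (νN : Measure ↥(unipDelta L e dV hdV dW hdW)) [νN.IsHaarMeasure]
    [DecidableEq (HeightOneSpectrum (𝓞 (Fp L)))]
    [MeasurableSpace ↥(unipDeltaArch L e dV hdV dW hdW)] [BorelSpace ↥(unipDeltaArch L e dV hdV dW hdW)]
    [∀ v : HeightOneSpectrum (𝓞 (Fp L)), MeasurableSpace ↥(unipDeltaLoc L e dV hdV dW hdW v)]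
    [∀ v : HeightOneSpectrum (𝓞 (Fp L)), BorelSpace ↥(unipDeltaLoc L e dV hdV dW hdW v)] :
    ∃ (T₀ : Finset (HeightOneSpectrum (𝓞 (Fp L))))
      (νv : ∀ v : HeightOneSpectrum (𝓞 (Fp L)), Measure ↥(unipDeltaLoc L e dV hdV dW hdW v))
      (_ : ∀ v, (νv v).IsHaarMeasure) (_ : ∀ v, SigmaFinite (νv v)),
      (∀ v, νv v (((inH (fun v => UnitaryGroup.localInt L (IsCMField.complexConj L) (n + n) (hermD L e dV hdV dW hdW) v)
        (fun v => unipDeltaLoc L e dV hdV dW hdW v) v) : Subgroup ↥(unipDeltaLoc L e dV hdV dW hdW v)) : Set ↥(unipDeltaLoc L e dV hdV dW hdW v)) = 1) ∧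
      ∃ νinf : Finset (HeightOneSpectrum (𝓞 (Fp L))) → Measure ↥(unipDeltaArch L e dV hdV dW hdW),
        (∀ T, SigmaFinite (νinf T)) ∧
        (∀ T : Finset (HeightOneSpectrum (𝓞 (Fp L))), Measure.map (unipDeltaSplitAt L e dV hdV dW hdW T) νN =
          (νinf T).prod ((Measure.pi fun v : T => νv v.1).prod
            (rpMeasure (fun v : {v : HeightOneSpectrum (𝓞 (Fp L)) // v ∉ T} => ((inH (fun v => UnitaryGroup.localInt L (IsCMField.complexConj L) (n + n) (hermD L e dV hdV dW hdW) v)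
              (fun v => unipDeltaLoc L e dV hdV dW hdW v) v.1 : Subgroup ↥(unipDeltaLoc L e dV hdV dW hdW v.1)) : Set ↥(unipDeltaLoc L e dV hdV dW hdW v.1))) (fun v => νv v.1) ∅))) ∧
        (∀ v, v ∉ T₀ → ∀ w' : UnitaryGroup.PlacesOver L v, χ.IsUnramifiedAt w'.1) := by
  -- the local carriers (§1), unpacked by projections (an `obtain` here re-elaborates the instance-laden goal and times out)
  have h := exists_localCarriers L e dV hdV dW hdW
  have hH : ∀ v, (h.choose v).IsHaarMeasure := h.choose_spec.choose
  have hσv : ∀ v, SigmaFinite (h.choose v) := h.choose_spec.choose_spec.choose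
  have hνK := h.choose_spec.choose_spec.choose_spec
  -- the factorisation at every finite `T` (★ Φ3b), chosen per `T`
  have hfac := fun T : Finset (HeightOneSpectrum (𝓞 (Fp L))) =>
    exists_isHaarMeasure_map_unipDeltaSplit_eq_prod_pi_rpMeasure L e dV hdV dW hdW T νN h.choose (fun v _ => hνK v)
  -- ramification of `χ` is finite
  have hfin : {w : HeightOneSpectrum (𝓞 L) | ¬χ.IsUnramifiedAt w}.Finite :=
    Filter.eventually_cofinite.1 (HeckeCharacter.isUnramifiedAt_cofinite_holds χ)
  refine ⟨hfin.toFinset.image (fun w => w.under (𝓞 (Fp L))), h.choose, hH, hσv, hνK, fun T => (hfac T).choose, fun T => (hfac T).choose_spec.2.1,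
    fun T => (hfac T).choose_spec.2.2, fun v hv w' => ?_⟩
  by_contra hw
  exact hv (Finset.mem_image.2 ⟨w'.1, hfin.mem_toFinset.2 hw, w'.2⟩)

/-! ## §3 (ED. 2) The same carriers, with the archimedean Haar clause exported -/

/-- **THE KIND-W CARRIER LETTERS WITH `νinf T` HAAR** (ED. 2; KW desk F0P2-p08 (g3) on K2Liu-p11 (g5)'s flag 00:01:55Z): `exists_kindW_carrierLetters` VERBATIM plus the clause
`∀ T, (νinf T).IsHaarMeasure` — ★ Φ3b `exists_isHaarMeasure_map_unipDeltaSplit_eq_prod_pi_rpMeasure`'s first conjunct, previously dropped — which the archimedean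
integrability payers (★ `K2LiuKindWArchLetterIntegrable(Bridge)`: `[∀ T', (νinf T').IsHaarMeasure]`) and the `hex` bridges take as an instance.  Same construction, one
more projection. [cite: Weil1965, §37] [cite: Tan1999, §3] -/
theorem exists_kindW_carrierLetters_haar (χ : HeckeCharacter L)
    [MeasurableSpace ↥(unipDelta L e dV hdV dW hdW)] [BorelSpace ↥(unipDelta L e dV hdV dW hdW)]
    (νN : Measure ↥(unipDelta L e dV hdV dW hdW)) [νN.IsHaarMeasure]
    [DecidableEq (HeightOneSpectrum (𝓞 (Fp L)))]
    [MeasurableSpace ↥(unipDeltaArch L e dV hdV dW hdW)] [BorelSpace ↥(unipDeltaArch L e dV hdV dW hdW)]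
    [∀ v : HeightOneSpectrum (𝓞 (Fp L)), MeasurableSpace ↥(unipDeltaLoc L e dV hdV dW hdW v)]
    [∀ v : HeightOneSpectrum (𝓞 (Fp L)), BorelSpace ↥(unipDeltaLoc L e dV hdV dW hdW v)] :
    ∃ (T₀ : Finset (HeightOneSpectrum (𝓞 (Fp L))))
      (νv : ∀ v : HeightOneSpectrum (𝓞 (Fp L)), Measure ↥(unipDeltaLoc L e dV hdV dW hdW v))
      (_ : ∀ v, (νv v).IsHaarMeasure) (_ : ∀ v, SigmaFinite (νv v)),
      (∀ v, νv v (((inH (fun v => UnitaryGroup.localInt L (IsCMField.complexConj L) (n + n) (hermD L e dV hdV dW hdW) v)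
        (fun v => unipDeltaLoc L e dV hdV dW hdW v) v) : Subgroup ↥(unipDeltaLoc L e dV hdV dW hdW v)) : Set ↥(unipDeltaLoc L e dV hdV dW hdW v)) = 1) ∧
      ∃ νinf : Finset (HeightOneSpectrum (𝓞 (Fp L))) → Measure ↥(unipDeltaArch L e dV hdV dW hdW),
        (∀ T, (νinf T).IsHaarMeasure) ∧
        (∀ T, SigmaFinite (νinf T)) ∧
        (∀ T : Finset (HeightOneSpectrum (𝓞 (Fp L))), Measure.map (unipDeltaSplitAt L e dV hdV dW hdW T) νN =
          (νinf T).prod ((Measure.pi fun v : T => νv v.1).prod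
            (rpMeasure (fun v : {v : HeightOneSpectrum (𝓞 (Fp L)) // v ∉ T} => ((inH (fun v => UnitaryGroup.localInt L (IsCMField.complexConj L) (n + n) (hermD L e dV hdV dW hdW) v)
              (fun v => unipDeltaLoc L e dV hdV dW hdW v) v.1 : Subgroup ↥(unipDeltaLoc L e dV hdV dW hdW v.1)) : Set ↥(unipDeltaLoc L e dV hdV dW hdW v.1))) (fun v => νv v.1) ∅))) ∧
        (∀ v, v ∉ T₀ → ∀ w' : UnitaryGroup.PlacesOver L v, χ.IsUnramifiedAt w'.1) := by
  -- the local carriers (§1), unpacked by projections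
  have h := exists_localCarriers L e dV hdV dW hdW
  have hH : ∀ v, (h.choose v).IsHaarMeasure := h.choose_spec.choose
  have hσv : ∀ v, SigmaFinite (h.choose v) := h.choose_spec.choose_spec.choose
  have hνK := h.choose_spec.choose_spec.choose_spec
  -- the factorisation at every finite `T` (★ Φ3b), chosen per `T`; its first conjunct is the Haar clause
  have hfac := fun T : Finset (HeightOneSpectrum (𝓞 (Fp L))) =>
    exists_isHaarMeasure_map_unipDeltaSplit_eq_prod_pi_rpMeasure L e dV hdV dW hdW T νN h.choose (fun v _ => hνK v)
  -- ramification of `χ` is finite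
  have hfin : {w : HeightOneSpectrum (𝓞 L) | ¬χ.IsUnramifiedAt w}.Finite :=
    Filter.eventually_cofinite.1 (HeckeCharacter.isUnramifiedAt_cofinite_holds χ)
  refine ⟨hfin.toFinset.image (fun w => w.under (𝓞 (Fp L))), h.choose, hH, hσv, hνK, fun T => (hfac T).choose, fun T => (hfac T).choose_spec.1,
    fun T => (hfac T).choose_spec.2.1, fun T => (hfac T).choose_spec.2.2, fun v hv w' => ?_⟩
  by_contra hw
  exact hv (Finset.mem_image.2 ⟨w'.1, hfin.mem_toFinset.2 hw, w'.2⟩)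

end Summit.HodgeConjecture.HodgeConjecture.Cruxes.HLiu418.K2LiuKindWCarrierOfRecord

end
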